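import Mathlib
import Summits.Ventures.PercRepro2.TypedContract

/-!
# The typed reduction rules for STATE KERNELS (blind cell PercRepro2, p2 g0, 2026-08-25; sub-claim
S1, `proofs/subclaims/S1-REDUCTION.md`; the lead's ruling INBOX 2026-08-25T01:33:49Z (1))

Night-3's reduction rules (TypedContract / TypedClosed / TypedParallel / TypedSeries / TypedPendant)
are stated for the cubic kernel `K₃` of row 2′TRI. Their proofs use `K₃` only through
`K3_eq_KB : K₃ x y w = KB (st x) (st y) (st w)` and a STATE identity (`st_contract_open`,
`st_update_loop`, `st_update_closed_unmarked`, `st_parallel`, `st_series`), except the root-pair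
rule (which needs the kernel to vanish when a copy has `a₁ ↔ a₂`) and the pendant rules (which
need the kill identities `KB_killB` / `KB_killO`). Here the same rules are proved for EVERY kernel
`stKer KK := fun x y w => KK (st x) (st y) (st w)` factoring through the 7-coordinate state, with
the two kernel-specific facts as NAMED HYPOTHESES — so that the calculus (and the residual-class
spine, `TypedSpineSt.lean`) applies verbatim to any other 3-copy kernel of the cell, in particular
to the cleared case-1 inequality (ii) of row 2′J1-RV once it is written as a state kernel.

* `typedCount_contract_open_st`, `typedCount_loop_st`, `typedCount_unmarked_leaf_st`,
  `typedCount_parallel_st`, `typedCount_series_st` — no hypothesis on `KK`;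
* `typedCount_root_pair_st` — hypothesis `hq : KK x y w = 0` whenever some copy has `q′ = true`;
* `typedCount_pendant_b_st` / `typedCount_pendant_o_st` — hypotheses: a decomposition
  `KK = KKx + KKy + KKz` by the copy carrying the mark's factor and the kill identity (isolating
  the mark in a copy kills exactly the terms whose factor sits in that copy). The pendant-`a₃`
  rule has no such form for `K₃` nor for (ii) (two `a₃`-factors per term) and is not stated.

Own code (the proofs are night-3's, with `K₃` abstracted); standard axioms.
-/

namespace Summit.Ventures.PercRepro2

open UnionCluster

namespace CovForm

namespace TypedRed

open OneTyped Contract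

/-! ## State kernels -/

section StKer

variable {V : Type*} {E : Type*} {R : Type*}

/-- A configuration kernel factoring through the states of the three copies. -/
noncomputable def stKer (ends : E → Sym2 V) (o a₁ a₂ a₃ b : V) (KK : St → St → St → R) :
    Config E → Config E → Config E → R :=
  fun x y w => KK (st ends o a₁ a₂ a₃ b x) (st ends o a₁ a₂ a₃ b y) (st ends o a₁ a₂ a₃ b w)

/-- `K₃` is the state kernel of `KB`. -/
lemma K3_eq_stKer [Field R] (ends : E → Sym2 V) (o a₁ a₂ a₃ b : V) :
    (K3 ends o a₁ a₂ a₃ b : Config E → Config E → Config E → R) =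
      stKer ends o a₁ a₂ a₃ b (fun x y w => ((KB x y w : ℤ) : R)) := by
  funext x y w
  exact K3_eq_KB ends o a₁ a₂ a₃ b x y w

end StKer

/-! ## The state-level rules -/

section Rules

variable {V : Type*} {E : Type*} [DecidableEq V] [Fintype E] [DecidableEq E] {R : Type*} [Field R]
variable (ends : E → Sym2 V) (o a₁ a₂ a₃ b : V) (KK : St → St → St → R)

/-- **Contracting a pinned-open edge** for a state kernel. -/
theorem typedCount_contract_open_st {g : E} {u v : V} (hg : ends g = s(u, v)) (F : Finset E)
    (hgF : g ∉ F) (z : Config E) (hz : z g = true) (τ : E → ℕ) :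
    typedCount F z τ (stKer ends o a₁ a₂ a₃ b KK) =
      typedCount F z τ (stKer (contractEnds ends {u, v} u) (contractMap {u, v} u o)
        (contractMap {u, v} u a₁) (contractMap {u, v} u a₂) (contractMap {u, v} u a₃)
        (contractMap {u, v} u b) KK) := by
  refine typedCount_congr_K_on _ _ _ fun x y w hxyw _ => ?_
  obtain ⟨hx, hy, hw⟩ := hxyw g hgF
  unfold stKer
  rw [st_contract_open ends o a₁ a₂ a₃ b hg (hx.trans hz),
    st_contract_open ends o a₁ a₂ a₃ b hg (hy.trans hz),
    st_contract_open ends o a₁ a₂ a₃ b hg (hw.trans hz)]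

omit [DecidableEq V] in
/-- **Typed loop** for a state kernel: `N_τ = C(3, τ f) · N_{τ[f := 0]}`. -/
theorem typedCount_loop_st {f : E} {u : V} (hf : ends f = s(u, u)) (F : Finset E) (hfF : f ∈ F)
    (z : Config E) (τ : E → ℕ) :
    typedCount F z τ (stKer ends o a₁ a₂ a₃ b KK) =
      (Nat.choose 3 (τ f) : R) * typedCount F z (Function.update τ f 0) (stKer ends o a₁ a₂ a₃ b KK) := by
  have hinv : ∀ (p q r : Bool), typedCount (F.erase f) (Function.update z f false) τ
      (fun x y w => stKer ends o a₁ a₂ a₃ b KK (Function.update x f p) (Function.update y f q)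
        (Function.update w f r)) =
      typedCount (F.erase f) (Function.update z f false) τ
        (fun x y w => stKer ends o a₁ a₂ a₃ b KK (Function.update x f false)
          (Function.update y f false) (Function.update w f false)) := by
    intro p q r
    refine typedCount_congr_K _ _ _ fun x y w => ?_
    unfold stKer
    rw [st_update_loop ends o a₁ a₂ a₃ b hf x p, st_update_loop ends o a₁ a₂ a₃ b hf y q,
      st_update_loop ends o a₁ a₂ a₃ b hf w r, st_update_loop ends o a₁ a₂ a₃ b hf x false,
      st_update_loop ends o a₁ a₂ a₃ b hf y false, st_update_loop ends o a₁ a₂ a₃ b hf w false]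
  rw [typedCount_split F f hfF, typedCount_split_zero F f hfF]
  simp only [hinv]
  exact sum_bool3_choose (τ f) _

omit [DecidableEq V] in
/-- **Unmarked leaf (rule (c′))** for a state kernel: `N_τ = C(3, τ f) · N_{τ[f := 0]}`. -/
theorem typedCount_unmarked_leaf_st {f : E} {l u : V} (hf : ends f = s(l, u)) (hlu : l ≠ u)
    (hlo : l ≠ o) (hl1 : l ≠ a₁) (hl2 : l ≠ a₂) (hl3 : l ≠ a₃) (hlb : l ≠ b) (F : Finset E)
    (hfF : f ∈ F) (z : Config E) (τ : E → ℕ)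
    (hcl : ∀ e', e' ≠ f → l ∈ ends e' → e' ∉ F ∧ z e' = false) :
    typedCount F z τ (stKer ends o a₁ a₂ a₃ b KK) =
      (Nat.choose 3 (τ f) : R) * typedCount F z (Function.update τ f 0) (stKer ends o a₁ a₂ a₃ b KK) := by
  have hinv : ∀ (p q r : Bool), typedCount (F.erase f) (Function.update z f false) τ
      (fun x y w => stKer ends o a₁ a₂ a₃ b KK (Function.update x f p) (Function.update y f q)
        (Function.update w f r)) =
      typedCount (F.erase f) (Function.update z f false) τ
        (fun x y w => stKer ends o a₁ a₂ a₃ b KK (Function.update x f false)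
          (Function.update y f false) (Function.update w f false)) := by
    intro p q r
    refine typedCount_congr_K_on _ _ _ fun x y w hxyw _ => ?_
    have hx := closed_on_support ends F z hcl x fun e he => (hxyw e he).1
    have hy := closed_on_support ends F z hcl y fun e he => (hxyw e he).2.1
    have hw := closed_on_support ends F z hcl w fun e he => (hxyw e he).2.2
    unfold stKer
    rw [st_update_closed_unmarked ends o a₁ a₂ a₃ b hf hlu hlo hl1 hl2 hl3 hlb hx p,
      st_update_closed_unmarked ends o a₁ a₂ a₃ b hf hlu hlo hl1 hl2 hl3 hlb hy q,
      st_update_closed_unmarked ends o a₁ a₂ a₃ b hf hlu hlo hl1 hl2 hl3 hlb hw r]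
  rw [typedCount_split F f hfF, typedCount_split_zero F f hfF]
  simp only [hinv]
  exact sum_bool3_choose (τ f) _

omit [DecidableEq V] in
/-- **Parallel typed edges (rule (b))** for a state kernel. -/
theorem typedCount_parallel_st {e f : E} (hef : e ≠ f) (hpar : ends e = ends f) (F : Finset E)
    (heF : e ∈ F) (hfF : f ∈ F) (z : Config E) (τ : E → ℕ) (hτe : τ e = 1 ∨ τ e = 2)
    (hτf : τ f = 1 ∨ τ f = 2) :
    typedCount F z τ (stKer ends o a₁ a₂ a₃ b KK) =
      ∑ j ∈ Finset.range 4, (muOr (τ e) (τ f) j : R) *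
        typedCount (F.erase f) (Function.update z f false) (Function.update τ e j)
          (stKer ends o a₁ a₂ a₃ b KK) := by
  have heF' : e ∈ F.erase f := Finset.mem_erase.2 ⟨hef, heF⟩
  have hfF'' : f ∉ (F.erase f).erase e := fun h => (Finset.mem_erase.1 (Finset.mem_erase.1 h).2).1 rfl
  have hz'' : Function.update (Function.update z f false) e false f = false := by
    rw [Function.update_of_ne (Ne.symm hef), Function.update_self]
  set T : Bool → Bool → Bool → R := fun p q r =>
    typedCount ((F.erase f).erase e) (Function.update (Function.update z f false) e false) τ
      (fun x y w => stKer ends o a₁ a₂ a₃ b KK (Function.update x e p) (Function.update y e q)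
        (Function.update w e r)) with hT
  have hL : typedCount F z τ (stKer ends o a₁ a₂ a₃ b KK) =
      ∑ a : Bool, ∑ b' : Bool, ∑ c : Bool, if a.toNat + b'.toNat + c.toNat = τ f then
        (∑ p : Bool, ∑ q : Bool, ∑ r : Bool, if p.toNat + q.toNat + r.toNat = τ e then
          T (p || a) (q || b') (r || c) else 0) else 0 := by
    rw [typedCount_split F f hfF]
    refine Finset.sum_congr rfl fun a _ => Finset.sum_congr rfl fun b' _ =>
      Finset.sum_congr rfl fun c _ => ?_
    refine if_congr Iff.rfl ?_ rfl
    rw [typedCount_split (F.erase f) e heF']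
    refine Finset.sum_congr rfl fun p _ => Finset.sum_congr rfl fun q _ =>
      Finset.sum_congr rfl fun r _ => ?_
    refine if_congr Iff.rfl ?_ rfl
    rw [hT]
    simp only
    rw [← typedCount_update_pinned ((F.erase f).erase e) f hfF'' _ τ
      (fun x y w => stKer ends o a₁ a₂ a₃ b KK (Function.update x e (p || a))
        (Function.update y e (q || b')) (Function.update w e (r || c))) false hz'']
    refine typedCount_congr_K _ _ _ fun x y w => ?_
    unfold stKer
    rw [st_parallel ends o a₁ a₂ a₃ b hef hpar x p a, st_parallel ends o a₁ a₂ a₃ b hef hpar y q b',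
      st_parallel ends o a₁ a₂ a₃ b hef hpar w r c]
  have hR : ∀ j : ℕ, typedCount (F.erase f) (Function.update z f false) (Function.update τ e j)
      (stKer ends o a₁ a₂ a₃ b KK) =
      ∑ p : Bool, ∑ q : Bool, ∑ r : Bool, if p.toNat + q.toNat + r.toNat = j then T p q r else 0 := by
    intro j
    rw [typedCount_split (F.erase f) e heF']
    refine Finset.sum_congr rfl fun p _ => Finset.sum_congr rfl fun q _ =>
      Finset.sum_congr rfl fun r _ => ?_
    rw [Function.update_self]
    refine if_congr Iff.rfl ?_ rfl
    rw [hT]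
    simp only
    refine typedCount_congr_τ _ _ (fun e' he' => ?_) _
    rw [Function.update_of_ne (Finset.ne_of_mem_erase he')]
  rw [hL]
  simp only [hR]
  exact sum_bool3_parallel (τ e) (τ f) hτe hτf T

omit [DecidableEq V] in
/-- **Series typed edges (rule (a))** for a state kernel. -/
theorem typedCount_series_st {e f : E} (hef : e ≠ f) {u w v : V} (he : ends e = s(u, w))
    (hf : ends f = s(w, v)) (hwu : w ≠ u) (hwv : w ≠ v) (hwo : w ≠ o) (hw1 : w ≠ a₁) (hw2 : w ≠ a₂)
    (hw3 : w ≠ a₃) (hwb : w ≠ b) (F : Finset E) (heF : e ∈ F) (hfF : f ∈ F) (z : Config E)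
    (τ : E → ℕ) (hτe : τ e = 1 ∨ τ e = 2) (hτf : τ f = 1 ∨ τ f = 2)
    (hcl : ∀ e', e' ≠ e → e' ≠ f → w ∈ ends e' → e' ∉ F ∧ z e' = false) :
    typedCount F z τ (stKer ends o a₁ a₂ a₃ b KK) =
      ∑ j ∈ Finset.range 4, (muAnd (τ e) (τ f) j : R) *
        typedCount (F.erase f) (Function.update z f true) (Function.update τ e j)
          (stKer ends o a₁ a₂ a₃ b KK) := by
  have heF' : e ∈ F.erase f := Finset.mem_erase.2 ⟨hef, heF⟩
  have hfF'' : f ∉ (F.erase f).erase e := fun h => (Finset.mem_erase.1 (Finset.mem_erase.1 h).2).1 rfl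
  have hzT : Function.update (Function.update z f true) e false f = true := by
    rw [Function.update_of_ne (Ne.symm hef), Function.update_self]
  have hzz : Function.update (Function.update (Function.update z f true) e false) f false =
      Function.update (Function.update z f false) e false := by
    rw [Function.update_comm (Ne.symm hef), Function.update_idem, Function.update_comm hef]
  set T : Bool → Bool → Bool → R := fun p q r =>
    typedCount ((F.erase f).erase e) (Function.update (Function.update z f true) e false) τ
      (fun x y w => stKer ends o a₁ a₂ a₃ b KK (Function.update x e p) (Function.update y e q)
        (Function.update w e r)) with hT
  have hL : typedCount F z τ (stKer ends o a₁ a₂ a₃ b KK) =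
      ∑ a : Bool, ∑ b' : Bool, ∑ c : Bool, if a.toNat + b'.toNat + c.toNat = τ f then
        (∑ p : Bool, ∑ q : Bool, ∑ r : Bool, if p.toNat + q.toNat + r.toNat = τ e then
          T (p && a) (q && b') (r && c) else 0) else 0 := by
    rw [typedCount_split F f hfF]
    refine Finset.sum_congr rfl fun a _ => Finset.sum_congr rfl fun b' _ =>
      Finset.sum_congr rfl fun c _ => ?_
    refine if_congr Iff.rfl ?_ rfl
    rw [typedCount_split (F.erase f) e heF']
    refine Finset.sum_congr rfl fun p _ => Finset.sum_congr rfl fun q _ =>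
      Finset.sum_congr rfl fun r _ => ?_
    refine if_congr Iff.rfl ?_ rfl
    rw [hT]
    simp only
    rw [typedCount_repin_false ((F.erase f).erase e) f hfF''
      (Function.update (Function.update z f true) e false) τ _, hzT, hzz]
    refine typedCount_congr_K_on _ _ _ fun x y w hxyw _ => ?_
    have hx := closed_on_support2 F z hcl x fun e' he' => (hxyw e' he').1
    have hy := closed_on_support2 F z hcl y fun e' he' => (hxyw e' he').2.1
    have hw := closed_on_support2 F z hcl w fun e' he' => (hxyw e' he').2.2
    unfold stKer
    rw [st_series ends o a₁ a₂ a₃ b hef he hf hwu hwv hwo hw1 hw2 hw3 hwb x hx p a,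
      st_series ends o a₁ a₂ a₃ b hef he hf hwu hwv hwo hw1 hw2 hw3 hwb y hy q b',
      st_series ends o a₁ a₂ a₃ b hef he hf hwu hwv hwo hw1 hw2 hw3 hwb w hw r c]
  have hR : ∀ j : ℕ, typedCount (F.erase f) (Function.update z f true) (Function.update τ e j)
      (stKer ends o a₁ a₂ a₃ b KK) =
      ∑ p : Bool, ∑ q : Bool, ∑ r : Bool, if p.toNat + q.toNat + r.toNat = j then T p q r else 0 := by
    intro j
    rw [typedCount_split (F.erase f) e heF']
    refine Finset.sum_congr rfl fun p _ => Finset.sum_congr rfl fun q _ =>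
      Finset.sum_congr rfl fun r _ => ?_
    rw [Function.update_self]
    refine if_congr Iff.rfl ?_ rfl
    rw [hT]
    simp only
    refine typedCount_congr_τ _ _ (fun e' he' => ?_) _
    rw [Function.update_of_ne (Finset.ne_of_mem_erase he')]
  rw [hL]
  simp only [hR]
  exact sum_bool3_series (τ e) (τ f) hτe hτf T

omit [DecidableEq V] in
open Classical in
/-- **Root pair** for a state kernel vanishing on every state triple with a copy in which
`a₁ ↔ a₂`. -/
theorem typedCount_root_pair_st
    (hq : ∀ x y w : St, x.q' = true ∨ y.q' = true ∨ w.q' = true → KK x y w = 0) {f : E}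
    (hf : ends f = s(a₁, a₂)) (F : Finset E) (hfF : f ∈ F) (z : Config E) (τ : E → ℕ)
    (hτ : 1 ≤ τ f) :
    typedCount F z τ (stKer ends o a₁ a₂ a₃ b KK) = 0 := by
  have hqx : ∀ x : Config E, x f = true → (st ends o a₁ a₂ a₃ b x).q' = true := by
    intro x hx
    show decide (Conn ends x a₂ a₁) = true
    exact decide_eq_true (conn_of_openAdj ⟨f, hx, by rw [hf, Sym2.eq_swap]⟩)
  unfold typedCount
  refine Finset.sum_eq_zero fun x _ => Finset.sum_eq_zero fun y _ => Finset.sum_eq_zero fun w _ => ?_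
  split_ifs with h
  · have hc := h.2 f hfF
    have hopen : x f = true ∨ y f = true ∨ w f = true := by
      by_contra hno
      simp only [not_or] at hno
      obtain ⟨hx, hy, hw⟩ := hno
      have hx' : x f = false := Bool.eq_false_iff.mpr hx
      have hy' : y f = false := Bool.eq_false_iff.mpr hy
      have hw' : w f = false := Bool.eq_false_iff.mpr hw
      simp only [openCount, hx', hy', hw', Bool.toNat_false] at hc
      omega
    unfold stKer
    rcases hopen with hx | hy | hw
    · exact hq _ _ _ (Or.inl (hqx x hx))
    · exact hq _ _ _ (Or.inr (Or.inl (hqx y hy)))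
    · exact hq _ _ _ (Or.inr (Or.inr (hqx w hw)))
  · rfl

omit [DecidableEq V] in
/-- **Pendant `b` (rule (d′))** for a state kernel with a `b`-decomposition `KK = KKx + KKy + KKz`
(the terms whose `b`-factor sits in the first / second / third copy) satisfying the kill
identity. -/
theorem typedCount_pendant_b_st (KKx KKy KKz : St → St → St → R)
    (hsum : ∀ x y w : St, KK x y w = KKx x y w + KKy x y w + KKz x y w)
    (hkill : ∀ (p q r : Bool) (x y w : St),
      KK (cond p x (killB x)) (cond q y (killB y)) (cond r w (killB w)) =
        (if p then KKx x y w else 0) + (if q then KKy x y w else 0) + (if r then KKz x y w else 0))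
    {f : E} {u : V} (hf : ends f = s(b, u)) (hbu : b ≠ u) (hbo : b ≠ o) (hb1 : b ≠ a₁)
    (hb2 : b ≠ a₂) (hb3 : b ≠ a₃) (F : Finset E) (hfF : f ∈ F) (z : Config E) (τ : E → ℕ)
    (hτ : 1 ≤ τ f) (hcl : ∀ e', e' ≠ f → b ∈ ends e' → e' ∉ F ∧ z e' = false) :
    typedCount F z τ (stKer ends o a₁ a₂ a₃ b KK) =
      (Nat.choose 2 (τ f - 1) : R) *
        typedCount F z (Function.update τ f 3) (stKer ends o a₁ a₂ a₃ b KK) := by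
  set S := st ends o a₁ a₂ a₃ b with hS
  set X : R := typedCount (F.erase f) (Function.update z f false) τ
    (fun x y w => KKx (S (Function.update x f true)) (S (Function.update y f true))
      (S (Function.update w f true))) with hX
  set Y : R := typedCount (F.erase f) (Function.update z f false) τ
    (fun x y w => KKy (S (Function.update x f true)) (S (Function.update y f true))
      (S (Function.update w f true))) with hY
  set Z : R := typedCount (F.erase f) (Function.update z f false) τ
    (fun x y w => KKz (S (Function.update x f true)) (S (Function.update y f true))
      (S (Function.update w f true))) with hZ
  have hst : ∀ (x : Config E), (∀ e', e' ≠ f → b ∈ ends e' → x e' = false) → ∀ (p : Bool),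
      S (Function.update x f p) =
        cond p (S (Function.update x f true)) (killB (S (Function.update x f true))) := by
    intro x hx p
    cases p
    · exact st_update_closed_b ends o a₁ a₂ a₃ b hf hbu hbo hb1 hb2 hb3 hx
    · rfl
  have hsplit : ∀ (p q r : Bool), typedCount (F.erase f) (Function.update z f false) τ
      (fun x y w => stKer ends o a₁ a₂ a₃ b KK (Function.update x f p) (Function.update y f q)
        (Function.update w f r)) =
      (if p then X else 0) + (if q then Y else 0) + (if r then Z else 0) := by
    intro p q r
    rw [hX, hY, hZ, ← typedCount_ite, ← typedCount_ite, ← typedCount_ite, ← typedCount_add,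
      ← typedCount_add]
    refine typedCount_congr_K_on _ _ _ fun x y w hxyw _ => ?_
    have hx := closed_on_support ends F z hcl x fun e he => (hxyw e he).1
    have hy := closed_on_support ends F z hcl y fun e he => (hxyw e he).2.1
    have hw := closed_on_support ends F z hcl w fun e he => (hxyw e he).2.2
    unfold stKer
    rw [← hS, hst x hx p, hst y hy q, hst w hw r, hkill]
  rw [typedCount_split F f hfF]
  simp only [hsplit]
  rw [sum_bool3_pend3 (τ f) hτ X Y Z]
  congr 1
  rw [typedCount_split_three F f hfF, hX, hY, hZ, ← typedCount_add, ← typedCount_add]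
  refine typedCount_congr_K _ _ _ fun x y w => ?_
  unfold stKer
  rw [← hS, hsum]

omit [DecidableEq V] in
/-- **Pendant `o` (rule (d′))** for a state kernel with an `o`-decomposition satisfying the kill
identity. -/
theorem typedCount_pendant_o_st (KKx KKy KKz : St → St → St → R)
    (hsum : ∀ x y w : St, KK x y w = KKx x y w + KKy x y w + KKz x y w)
    (hkill : ∀ (p q r : Bool) (x y w : St),
      KK (cond p x (killO x)) (cond q y (killO y)) (cond r w (killO w)) =
        (if p then KKx x y w else 0) + (if q then KKy x y w else 0) + (if r then KKz x y w else 0))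
    {f : E} {u : V} (hf : ends f = s(o, u)) (hou : o ≠ u) (ho1 : o ≠ a₁) (ho2 : o ≠ a₂)
    (ho3 : o ≠ a₃) (hob : o ≠ b) (F : Finset E) (hfF : f ∈ F) (z : Config E) (τ : E → ℕ)
    (hτ : 1 ≤ τ f) (hcl : ∀ e', e' ≠ f → o ∈ ends e' → e' ∉ F ∧ z e' = false) :
    typedCount F z τ (stKer ends o a₁ a₂ a₃ b KK) =
      (Nat.choose 2 (τ f - 1) : R) *
        typedCount F z (Function.update τ f 3) (stKer ends o a₁ a₂ a₃ b KK) := by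
  set S := st ends o a₁ a₂ a₃ b with hS
  set X : R := typedCount (F.erase f) (Function.update z f false) τ
    (fun x y w => KKx (S (Function.update x f true)) (S (Function.update y f true))
      (S (Function.update w f true))) with hX
  set Y : R := typedCount (F.erase f) (Function.update z f false) τ
    (fun x y w => KKy (S (Function.update x f true)) (S (Function.update y f true))
      (S (Function.update w f true))) with hY
  set Z : R := typedCount (F.erase f) (Function.update z f false) τ
    (fun x y w => KKz (S (Function.update x f true)) (S (Function.update y f true))
      (S (Function.update w f true))) with hZ
  have hst : ∀ (x : Config E), (∀ e', e' ≠ f → o ∈ ends e' → x e' = false) → ∀ (p : Bool),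
      S (Function.update x f p) =
        cond p (S (Function.update x f true)) (killO (S (Function.update x f true))) := by
    intro x hx p
    cases p
    · exact st_update_closed_o ends o a₁ a₂ a₃ b hf hou ho1 ho2 ho3 hob hx
    · rfl
  have hsplit : ∀ (p q r : Bool), typedCount (F.erase f) (Function.update z f false) τ
      (fun x y w => stKer ends o a₁ a₂ a₃ b KK (Function.update x f p) (Function.update y f q)
        (Function.update w f r)) =
      (if p then X else 0) + (if q then Y else 0) + (if r then Z else 0) := by
    intro p q r
    rw [hX, hY, hZ, ← typedCount_ite, ← typedCount_ite, ← typedCount_ite, ← typedCount_add,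
      ← typedCount_add]
    refine typedCount_congr_K_on _ _ _ fun x y w hxyw _ => ?_
    have hx := closed_on_support ends F z hcl x fun e he => (hxyw e he).1
    have hy := closed_on_support ends F z hcl y fun e he => (hxyw e he).2.1
    have hw := closed_on_support ends F z hcl w fun e he => (hxyw e he).2.2
    unfold stKer
    rw [← hS, hst x hx p, hst y hy q, hst w hw r, hkill]
  rw [typedCount_split F f hfF]
  simp only [hsplit]
  rw [sum_bool3_pend3 (τ f) hτ X Y Z]
  congr 1
  rw [typedCount_split_three F f hfF, hX, hY, hZ, ← typedCount_add, ← typedCount_add]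
  refine typedCount_congr_K _ _ _ fun x y w => ?_
  unfold stKer
  rw [← hS, hsum]

end Rules

end TypedRed

end CovForm

end Summit.Ventures.PercRepro2
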